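import Summits.Langlands.Langlands.Theses.QuinticX0105Split
/-! BC3 birth skeleton for crux `QuinticX0105Modularity` of node/route `QuinticX0105Split` (lens-5 g17): 2 named stubs (sorry) + kernel-checked composition `QuinticX0105Modularity_of`. POST-BIRTH form: imports the route file and concludes the ROUTE decl by name (elaborates once Theses/QuinticX0105Split.lean exists). -/
set_option linter.dupNamespace false
set_option linter.unusedVariables false
open scoped BigOperators Topology Manifold Classical MeasureTheory ProbabilityTheory Matrix InnerProductSpace ComplexConjugate ContinuousMap
open Filter Set Function TopologicalSpace MeasureTheory
-- SKELETON SHAPE (writer-1 g6 fix for `skeleton.extra-hypothesis`): the composition `QuinticX0105Modularity_of` (hypotheses = stub statements) is folded into ONE closed theorem `QuinticX0105Modularity_proof : <route decl>` whose `have` lines invoke the sorried stubs; proof body unchanged.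
namespace Summit.Langlands.Langlands.Cruxes.QuinticX0105Modularity.Birth

/-- THE FINITE RANGE (decidable, not yet run): every quintic point of X₀(105) over a totally real quintic field is CM or has RATIONAL j (over a quintic field a ℚ-curve has j ∈ ℚ: no quadratic subfields). Decision procedure: J₀(105)(ℚ) finite (IIY Lemma 5.3(3)) + ℚ-gonality 6 (IIY Prop 5.5) ⇒ quintic points ↪ J₀(105)(ℚ)_tors (IIY Thm 3.3); enumerate torsion classes (cuspidal subgroup + Hecke/Hasse bounds), Riemann–Roch on Box 2022 genus-13 model. Analogue in degree 4: Box 2022 Thm 1.5 (all quartic points ℚ-curves). -/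
theorem stub_x105_points :
    ∀ (K : Type) [Field K] [NumberField K], NumberField.IsTotallyReal K → Module.finrank ℚ K = 5 → ∀ E : WeierstrassCurve (NumberField.RingOfIntegers K), E.Δ ≠ 0 → ((∃ ρ : Literature.NumberTheory.GaloisRepresentations.FramedGaloisRep K (ZMod 3) 2, (∃ e : (E.baseChange K).geomTorsion ((3 : ℕ) : ℤ) ≃+ (Fin 2 → ZMod 3), ∀ (σ : Field.absoluteGaloisGroup K) (P : (E.baseChange K).geomTorsion ((3 : ℕ) : ℤ)), e (σ • P) = ((ρ σ : GL (Fin 2) (ZMod 3)) : Matrix (Fin 2) (Fin 2) (ZMod 3)) *ᵥ (e P)) ∧ (∀ σ : Field.absoluteGaloisGroup K, (((ρ σ : GL (Fin 2) (ZMod 3)) : Matrix (Fin 2) (Fin 2) (ZMod 3)) 1 0 = 0))) ∧ (∃ ρ : Literature.NumberTheory.GaloisRepresentations.FramedGaloisRep K (ZMod 5) 2, (∃ e : (E.baseChange K).geomTorsion ((5 : ℕ) : ℤ) ≃+ (Fin 2 → ZMod 5), ∀ (σ : Field.absoluteGaloisGroup K) (P : (E.baseChange K).geomTorsion ((5 :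 ℕ) : ℤ)), e (σ • P) = ((ρ σ : GL (Fin 2) (ZMod 5)) : Matrix (Fin 2) (Fin 2) (ZMod 5)) *ᵥ (e P)) ∧ (∀ σ : Field.absoluteGaloisGroup K, (((ρ σ : GL (Fin 2) (ZMod 5)) : Matrix (Fin 2) (Fin 2) (ZMod 5)) 1 0 = 0))) ∧ (∃ ρ : Literature.NumberTheory.GaloisRepresentations.FramedGaloisRep K (ZMod 7) 2, (∃ e : (E.baseChange K).geomTorsion ((7 : ℕ) : ℤ) ≃+ (Fin 2 → ZMod 7), ∀ (σ : Field.absoluteGaloisGroup K) (P : (E.baseChange K).geomTorsion ((7 : ℕ) : ℤ)), e (σ • P) = ((ρ σ : GL (Fin 2) (ZMod 7)) : Matrix (Fin 2) (Fin 2) (ZMod 7)) *ᵥ (e P)) ∧ (∀ σ : Field.absoluteGaloisGroup K, (((ρ σ : GL (Fin 2) (ZMod 7)) : Matrix (Fin 2) (Fin 2) (ZMod 7)) 1 0 = 0)))) → ((E.baseChange K).HasCM ∨ (∃ q : ℚ, (E.baseChange K).c₄ ^ 3 = (q : K) * (E.baseChange K).Δ)) := by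
  sorry

/-- E over totally real quintic K with j(E) ∈ ℚ (c₄³ = q·Δ, q ∈ ℚ) is modular: j ∈ {0, 1728} ⇒ CM; else E is a quadratic twist of (E₀)_K with E₀/ℚ modular (BCDT) and base change of its newform to the totally real field K exists (Dieulefait 2015, base change to arbitrary totally real fields; or FLS big-image at 3/5/7 for non-exceptional E₀), twist by the quadratic Hecke character. PRINT. -/
theorem stub_rational_j :
    ∀ (K : Type) [Field K] [NumberField K], NumberField.IsTotallyReal K → Module.finrank ℚ K = 5 → ∀ E : WeierstrassCurve (NumberField.RingOfIntegers K), E.Δ ≠ 0 → (∃ q : ℚ, (E.baseChange K).c₄ ^ 3 = (q : K) * (E.baseChange K).Δ) → ((E.baseChange K).HasCM ∨ ∃ (hF : Literature.NumberTheory.Automorphic.isCompact_glFiniteIntegralLevel 2 K) (π : Literature.NumberTheory.Automorphic.CuspidalAutomorphicRepData 2 K hF), π.1.HasWeightZero ∧ ∀ᶠ w : IsDedekindDomain.HeightOneSpectrum (NumberField.RingOfIntegers K) in Filter.cofinite, ∃ α : Multiset ℂ, π.1.HasSatakeParamAt w α ∧ ((Real.sqrt w.residueCard : ℝ) : ℂ)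 * α.sum = (Literature.NumberTheory.Automorphic.frobTraceAt E w : ℂ)) := by
  sorry

/-- composition (real proof, no sorry): the stubs imply the crux. -/
theorem QuinticX0105Modularity_proof :
    Summit.Langlands.Langlands.Theses.QuinticX0105Split.QuinticX0105Modularity := by
  have h1 : (∀ (K : Type) [Field K] [NumberField K], NumberField.IsTotallyReal K → Module.finrank ℚ K = 5 → ∀ E : WeierstrassCurve (NumberField.RingOfIntegers K), E.Δ ≠ 0 → ((∃ ρ : Literature.NumberTheory.GaloisRepresentations.FramedGaloisRep K (ZMod 3) 2, (∃ e : (E.baseChange K).geomTorsion ((3 : ℕ) : ℤ) ≃+ (Fin 2 → ZMod 3), ∀ (σ : Field.absoluteGaloisGroup K) (P : (E.baseChange K).geomTorsion ((3 : ℕ) : ℤ)), e (σ • P) = ((ρ σ : GL (Fin 2) (ZMod 3)) : Matrix (Fin 2) (Fin 2) (ZMod 3)) *ᵥ (e P)) ∧ (∀ σ : Field.absoluteGaloisGroup K, (((ρ σ : GL (Fin 2) (ZMod 3)) : Matrix (Fin 2) (Fin 2) (ZMod 3)) 1 0 = 0))) ∧ (∃ ρ : Literature.NumberTheory.GaloisRepresentations.FramedGaloisRep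 K (ZMod 5) 2, (∃ e : (E.baseChange K).geomTorsion ((5 : ℕ) : ℤ) ≃+ (Fin 2 → ZMod 5), ∀ (σ : Field.absoluteGaloisGroup K) (P : (E.baseChange K).geomTorsion ((5 : ℕ) : ℤ)), e (σ • P) = ((ρ σ : GL (Fin 2) (ZMod 5)) : Matrix (Fin 2) (Fin 2) (ZMod 5)) *ᵥ (e P)) ∧ (∀ σ : Field.absoluteGaloisGroup K, (((ρ σ : GL (Fin 2) (ZMod 5)) : Matrix (Fin 2) (Fin 2) (ZMod 5)) 1 0 = 0))) ∧ (∃ ρ : Literature.NumberTheory.GaloisRepresentations.FramedGaloisRep K (ZMod 7) 2, (∃ e : (E.baseChange K).geomTorsion ((7 : ℕ) : ℤ) ≃+ (Fin 2 → ZMod 7), ∀ (σ : Field.absoluteGaloisGroup K) (P : (E.baseChange K).geomTorsion ((7 : ℕ) : ℤ)), e (σ • P) = ((ρ σ : GL (Fin 2) (ZMod 7)) : Matrix (Fin 2) (Fin 2) (ZMod 7)) *ᵥ (e P)) ∧ (∀ σ : Field.absoluteGaloisGroup K, (((ρ σ : GL (Fin 2) (ZMod 7)) : Matrix (Fin 2)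 (Fin 2) (ZMod 7)) 1 0 = 0)))) → ((E.baseChange K).HasCM ∨ (∃ q : ℚ, (E.baseChange K).c₄ ^ 3 = (q : K) * (E.baseChange K).Δ))) := stub_x105_points
  have h2 : (∀ (K : Type) [Field K] [NumberField K], NumberField.IsTotallyReal K → Module.finrank ℚ K = 5 → ∀ E : WeierstrassCurve (NumberField.RingOfIntegers K), E.Δ ≠ 0 → (∃ q : ℚ, (E.baseChange K).c₄ ^ 3 = (q : K) * (E.baseChange K).Δ) → ((E.baseChange K).HasCM ∨ ∃ (hF : Literature.NumberTheory.Automorphic.isCompact_glFiniteIntegralLevel 2 K) (π : Literature.NumberTheory.Automorphic.CuspidalAutomorphicRepData 2 K hF), π.1.HasWeightZero ∧ ∀ᶠ w : IsDedekindDomain.HeightOneSpectrum (NumberField.RingOfIntegers K) in Filter.cofinite, ∃ α : Multiset ℂ, π.1.HasSatakeParamAt w α ∧ ((Real.sqrt w.residueCard : ℝ) : ℂ) * α.sum = (Literature.NumberTheory.Automorphic.frobTraceAt E w : ℂ))) := stub_rational_j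
  intro K _ _ hK hd E hE hx
  rcases h1 K hK hd E hE hx with hcm | hq
  · exact Or.inl hcm
  · exact h2 K hK hd E hE hq


end Summit.Langlands.Langlands.Cruxes.QuinticX0105Modularity.Birth
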